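import Summits.AtomisticToContinuum.FouriersLaw.Theses.HiddenChargeMazur
import Summits.AtomisticToContinuum.FouriersLaw.Theorems.HiddenChargeMazurDressedChargeStubChargeSumCobd
import Summits.AtomisticToContinuum.FouriersLaw.Theorems.HiddenChargeMazurDressedChargeStubBlockOverlap
import Summits.AtomisticToContinuum.FouriersLaw.Theorems.HiddenChargeMazurDressedChargeOddCoboundaryOfNoLocalIntegrals
import HarnessLib

/-!
# `DressedCharge` from `NoLocalIntegrals` (crux stmt-AtomisticToContinuum-13509 of route
`HiddenChargeMazur`, closed MODULO item stmt-AtomisticToContinuum-12074; `--supports` helper)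

The line `birth` of the crux `DressedCharge`, assembled in the tree: IF every smooth local
conservation law of the infinite pinned anharmonic chain is `c·e₀ + (h − h∘τ) + k`
(`LocalOhmBV.NoLocalIntegrals`, item 12074), THEN `DressedCharge` holds — vacuously: the
hypothesised momentum-odd polynomial conserved density is a polynomial shift-coboundary
(`stub_oddChargeCoboundary_of_noLocalIntegrals`), its bulk charge telescopes to two boundary block
observables (`stub_chargeSumCobd`), and those have sub-extensive current overlap
(`stub_blockOverlap`), contradicting the extensive-overlap clause of the hypothesis.
The unconditional crux waits only on the classification (item 12074, or its odd polynomial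
shadow `stub_oddChargeCoboundary` registered on the crux).
-/

noncomputable section

open MeasureTheory
open Literature.MathematicalPhysics.KineticTheory.HeatConduction

namespace Summit.AtomisticToContinuum.FouriersLaw.Theorems.DressedCharge

/-- **`DressedCharge` from the odd polynomial coboundary classification** (the line's
composition, in the tree): if every momentum-odd polynomial density with a polynomial local
conservation law is a polynomial shift-coboundary, then `DressedCharge` holds (ex falso: the
overlap clause `c·N ≤ |E[J_N Q_N]|` of its hypothesis fails at large `N`). -/
theorem dressedCharge_of_oddChargeCoboundary
    (h1 : ∀ ω₂ lam β γ : ℝ, 0 < ω₂ → 0 < lam → 0 < β → 0 < γ →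
      ∀ P : OscillatorChain, P = pinnedChain ω₂ lam β γ →
      ∀ (R : ℕ) (g : (Fin (2 * R + 1) → ℝ × ℝ) → ℝ) (ψ : (Fin (2 * (R + 1) + 1) → ℝ × ℝ) → ℝ),
        (∃ p : MvPolynomial (Fin (2 * R + 1) ⊕ Fin (2 * R + 1)) ℝ, ∀ y : Fin (2 * R + 1) → ℝ × ℝ, g y = MvPolynomial.eval (Sum.elim (fun i => (y i).1) (fun i => (y i).2)) p) →
        (∃ p : MvPolynomial (Fin (2 * (R + 1) + 1) ⊕ Fin (2 * (R + 1) + 1)) ℝ, ∀ y : Fin (2 * (R + 1) + 1) → ℝ × ℝ, ψ y = MvPolynomial.eval (Sum.elim (fun i => (y i).1) (fun i => (y i).2)) p) →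
        (∀ y : Fin (2 * R + 1) → ℝ × ℝ, g (fun i => ((y i).1, -(y i).2)) = -g y) →
        (∀ σ : ℤ → ℝ × ℝ, (∑' x : ℤ, ((σ x).2 * deriv (fun t => g (fun i : Fin (2 * R + 1) => Function.update σ x (t, (σ x).2) ((i : ℤ) - (R : ℕ)))) (σ x).1 + (-deriv P.U (σ x).1 + (deriv P.V ((σ (x + 1)).1 - (σ x).1) - deriv P.V ((σ x).1 - (σ (x - 1)).1))) * deriv (fun t => g (fun i : Fin (2 * R + 1) => Function.update σ x ((σ x).1, t) ((i : ℤ) - (R : ℕ)))) (σ x).2)) = ψ (fun i : Fin (2 * (R + 1) + 1) => σ ((i : ℤ) - (R + 1 : ℕ))) - ψ (fun i : Fin (2 * (R + 1) + 1) => σ ((i : ℤ) - (R + 1 : ℕ) + 1))) →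
        ∃ k : (Fin (2 * R) → ℝ × ℝ) → ℝ,
          (∃ p : MvPolynomial (Fin (2 * R) ⊕ Fin (2 * R)) ℝ, ∀ w : Fin (2 * R) → ℝ × ℝ, k w = MvPolynomial.eval (Sum.elim (fun i => (w i).1) (fun i => (w i).2)) p) ∧
          ∀ y : Fin (2 * R + 1) → ℝ × ℝ, g y = k (fun i => y i.succ) - k (fun i => y (Fin.castSucc i))) :
    Summit.AtomisticToContinuum.FouriersLaw.Theses.HiddenChargeMazur.DressedCharge := by
  intro ω₂ lam β γ T hω hl hβ hγ hT P hP hcharge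
  exfalso
  obtain ⟨R, g, ψ, hg, hψ, hodd, hlaw, c, hc, N₀, hQ⟩ := hcharge
  -- the density is a polynomial coboundary
  obtain ⟨k, hk, hgk⟩ := h1 ω₂ lam β γ hω hl hβ hγ P hP R g ψ hg hψ hodd hlaw
  -- sub-extensive overlap of the two boundary blocks, with `c/3`
  obtain ⟨N₁, hN₁⟩ := stub_blockOverlap ω₂ lam β γ T hω hl hβ hγ hT P hP (2 * R) k hk (c / 3) (by positivity)
  set N : ℕ := max (max N₀ N₁) (max (2 * R) 1) with hNdef
  have hN₀ : N₀ ≤ N := le_trans (le_max_left _ _) (le_max_left _ _)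
  have hN₁' : N₁ ≤ N := le_trans (le_max_right _ _) (le_max_left _ _)
  have h2R : 2 * R ≤ N := le_trans (le_max_left _ _) (le_max_right _ _)
  have h1N : 1 ≤ N := le_trans (le_max_right _ _) (le_max_right _ _)
  obtain ⟨hIh, hIt, hhead, htail⟩ := hN₁ N hN₁'
  have hQN := hQ N hN₀
  -- telescoping of the bulk charge
  have htel : ∀ z : PhaseSpace N,
      (∑ x ∈ Finset.range (N - 2 * R), g (fun i => if h : x + i.val < N then (z.1 ⟨x + i.val, h⟩, z.2 ⟨x + i.val, h⟩) else (0, 0))) =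
      k (fun i : Fin (2 * R) => if h : N - 2 * R + i.val < N then (z.1 ⟨N - 2 * R + i.val, h⟩, z.2 ⟨N - 2 * R + i.val, h⟩) else (0, 0)) -
        k (fun i : Fin (2 * R) => if h : i.val < N then (z.1 ⟨i.val, h⟩, z.2 ⟨i.val, h⟩) else (0, 0)) := by
    intro z
    rw [← stub_chargeSumCobd R k N h2R z]
    exact Finset.sum_congr rfl fun x _ => hgk _
  have hov : (∫ z, (∑ i : Fin N, P.bondCurrent N i z) *
        (∑ x ∈ Finset.range (N - 2 * R), g (fun i => if h : x + i.val < N then (z.1 ⟨x + i.val, h⟩, z.2 ⟨x + i.val, h⟩) else (0, 0)))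
        ∂(MeasureTheory.volume.tilted fun x => -P.hamiltonian N x / T)) =
      (∫ z, (∑ i : Fin N, P.bondCurrent N i z) *
          k (fun i : Fin (2 * R) => if h : N - 2 * R + i.val < N then (z.1 ⟨N - 2 * R + i.val, h⟩, z.2 ⟨N - 2 * R + i.val, h⟩) else (0, 0))
          ∂(MeasureTheory.volume.tilted fun x => -P.hamiltonian N x / T)) -
      (∫ z, (∑ i : Fin N, P.bondCurrent N i z) *
          k (fun i : Fin (2 * R) => if h : i.val < N then (z.1 ⟨i.val, h⟩, z.2 ⟨i.val, h⟩) else (0, 0))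
          ∂(MeasureTheory.volume.tilted fun x => -P.hamiltonian N x / T)) := by
    rw [← integral_sub hIt hIh]
    refine integral_congr_ae (Filter.Eventually.of_forall fun z => ?_)
    simp only [htel z]
    ring
  rw [hov] at hQN
  have habs := (abs_sub _ _).trans (add_le_add htail hhead)
  have hNpos : (0 : ℝ) < N := by exact_mod_cast h1N
  nlinarith

/-- **`DressedCharge` modulo `NoLocalIntegrals`** (crux stmt-AtomisticToContinuum-13509 closed
modulo item stmt-AtomisticToContinuum-12074): the census of local conservation laws of the
pinned anharmonic chain implies the crux, through the bridge
`stub_oddChargeCoboundary_of_noLocalIntegrals` and the vacuity composition above. -/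
theorem stub_dressedCharge_of_noLocalIntegrals :
    Summit.AtomisticToContinuum.FouriersLaw.Theses.LocalOhmBV.NoLocalIntegrals →
      Summit.AtomisticToContinuum.FouriersLaw.Theses.HiddenChargeMazur.DressedCharge :=
  fun h => dressedCharge_of_oddChargeCoboundary (stub_oddChargeCoboundary_of_noLocalIntegrals h)

end Summit.AtomisticToContinuum.FouriersLaw.Theorems.DressedCharge

end
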